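import Mathlib
import HarnessLib
import Summits.ValiantsHypothesis.ValiantsHypothesis.Theorems.LacunarySymmetroidMatrixDescartesProductPlusOneRingIsoCurvature

/-!
# LINE (A) `product_plus_one` (crux `MatrixDescartes`, stmt-ValiantsHypothesis-18050, V1) — W-CB, brick C3a part 2: PER-ROW FACTS FOR THE IN-ZONE CELL

`L₃` regime `2p ≤ s`.  `ringIso_pole_facts`: a middle/fast POLE row (menu items P12 / P02 with the window sign) has a rate `r ∈ {s, p+s}` with NONNEGATIVE
generic coefficients `c₀(r), c₁(r)` (✓ `sixthOrder_c0/c1_mid/fast`) and, on the window, normal form `≠ 0`, both closure laws, `ψ₁ > 0`.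
`ringIso_knee_facts`: a middle/fast KNEE row whose window lies INSIDE its ring (E3b's bracket `< 0`) has its rate, its ring roots `0 < L < U`, `4U ≤ r²`,
`c₁(r) = 5040(L+U)`, `c₀(r) = 5040LU` (part 1 `midRing_roots` / `fastRing_roots`), and on the window normal form `≠ 0`, closure laws, `ψ₁ < 0`, bracket `< 0`
in generic form.  Consumed by part 3 (`…RingIsoPoles`).

HONEST FRAMING: bookkeeping; proves nothing about `WronskianBudgetK3` / `OneChangeFloorK3` / the stubs / 18050 / `MatrixDescartes` / B; `VP ≠ VNP` is NOT proved.
No definitions, no named facts, no sorry; Mathlib + ✓ lane modules only.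
-/

set_option linter.dupNamespace false

namespace Summit.ValiantsHypothesis.ValiantsHypothesis.Theorems.LacunarySymmetroidMatrixDescartes

namespace ProductPlusOne

open Finset Set Polynomial
open scoped BigOperators Topology Polynomial

/-! ### §4 Per-row facts: middle/fast poles (with the sign of their coefficients) and the ringed knee (with its ring roots) -/

/-- **Pole facts** (items P12 / P02 of the menu, `2p ≤ s`): a rate `r ∈ {s, p+s}` (listed in E3a's triple) with NONNEGATIVE generic coefficients
`c₀(r), c₁(r)`, and on the window: normal form `≠ 0`, both closure laws, `ψ₁ > 0`. [this file's lemma] -/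
theorem ringIso_pole_facts (e₁ e₂ : ℕ) (h2p : 2 * (e₁ + 1) ≤ e₂ + 1) (b : Fin 3 → ℝ) {u v : ℝ} (hu : 0 < u)
    (hrow :
      (b 0 = 0 ∧ b 1 * b 2 < 0 ∧ 0 ≤ (b 0 + b 1 * u ^ (e₁ + 1) + b 2 * u ^ (e₁ + e₂ + 2)) * (b 0 + b 1 * v ^ (e₁ + 1) + b 2 * v ^ (e₁ + e₂ + 2))) ∨
      (b 1 = 0 ∧ b 0 * b 2 < 0 ∧ 0 ≤ (b 0 + b 1 * u ^ (e₁ + 1) + b 2 * u ^ (e₁ + e₂ + 2)) * (b 0 + b 1 * v ^ (e₁ + 1) + b 2 * v ^ (e₁ + e₂ + 2)))) :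
    ∃ r : ℝ, (r = ((e₁ : ℝ) + 1) ∨ r = ((e₂ : ℝ) + 1) ∨ r = ((e₁ : ℝ) + 1) + ((e₂ : ℝ) + 1)) ∧
      0 ≤ 6 * (21 * r ^ 4 - 5 * (((e₁ : ℝ) + 1) ^ 2 + ((e₂ : ℝ) + 1) ^ 2 + (((e₁ : ℝ) + 1) + ((e₂ : ℝ) + 1)) ^ 2) * r ^ 2 + (((e₁ : ℝ) + 1) ^ 2
              * ((e₂ : ℝ) + 1) ^ 2 + ((e₁ : ℝ) + 1) ^ 2 * (((e₁ : ℝ) + 1) + ((e₂ : ℝ) + 1)) ^ 2 + ((e₂ : ℝ) + 1) ^ 2 * (((e₁ : ℝ) + 1) + ((e₂ : ℝ)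
              + 1)) ^ 2)) ∧
      0 ≤ 120 * (14 * r ^ 2 - (((e₁ : ℝ) + 1) ^ 2 + ((e₂ : ℝ) + 1) ^ 2 + (((e₁ : ℝ) + 1) + ((e₂ : ℝ) + 1)) ^ 2)) ∧ ∀ x ∈ Ioo u v,
      b 0 - (-(b 1)) * x ^ (e₁ + 1) - (-(b 2)) * x ^ (e₁ + e₂ + 2) ≠ 0 ∧
      rowPsi3 e₁ e₂ (b 0) (-(b 1)) (-(b 2)) x
        = r ^ 2 * rowPsi1 e₁ e₂ (b 0) (-(b 1)) (-(b 2)) x + 6 * rowPsi1 e₁ e₂ (b 0) (-(b 1)) (-(b 2)) x ^ 2 ∧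
      rowPsi2 e₁ e₂ (b 0) (-(b 1)) (-(b 2)) x ^ 2
        = r ^ 2 * rowPsi1 e₁ e₂ (b 0) (-(b 1)) (-(b 2)) x ^ 2 + 4 * rowPsi1 e₁ e₂ (b 0) (-(b 1)) (-(b 2)) x ^ 3 ∧
      0 < rowPsi1 e₁ e₂ (b 0) (-(b 1)) (-(b 2)) x := by
  set p : ℝ := (e₁ : ℝ) + 1 with hp
  set s : ℝ := (e₂ : ℝ) + 1 with hs
  have hp0 : 0 < p := by rw [hp]; positivity
  have hs0 : 0 < s := by rw [hs]; positivity
  have h2ps : 2 * p ≤ s := by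
    rw [hp, hs]
    have : ((2 * (e₁ + 1) : ℕ) : ℝ) ≤ ((e₂ + 1 : ℕ) : ℝ) := by exact_mod_cast h2p
    push_cast at this
    linarith
  have huv_pos : ∀ x ∈ Ioo u v, 0 < x := fun x hx => hu.trans hx.1
  rcases hrow with ⟨h0, hsgn, hend⟩ | ⟨h1, hsgn, hend⟩
  · -- (P12) pole, rate s
    refine ⟨s, Or.inr (Or.inl rfl), ?_, ?_, fun x hx => ?_⟩
    · rw [sixthOrder_c0_mid p s]
      have h1 : 0 ≤ s - p := by linarith
      have h2 : 0 ≤ 2 * s - p := by linarith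
      positivity
    · rw [sixthOrder_c1_mid p s]
      have h2 : 0 ≤ 2 * s - p := by linarith
      positivity
    have hx0 := huv_pos x hx
    have hv : 0 < v := hu.trans (hx.1.trans hx.2)
    have hb2 : b 2 ≠ 0 := by rintro h; rw [h, mul_zero] at hsgn; exact lt_irrefl _ hsgn
    have hend' : 0 ≤ (b 1 + b 2 * u ^ (e₂ + 1)) * (b 1 + b 2 * v ^ (e₂ + 1)) := by
      rw [h0] at hend
      have hfac : (0 + b 1 * u ^ (e₁ + 1) + b 2 * u ^ (e₁ + e₂ + 2)) * (0 + b 1 * v ^ (e₁ + 1) + b 2 * v ^ (e₁ + e₂ + 2))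
          = (u ^ (e₁ + 1) * v ^ (e₁ + 1)) * ((b 1 + b 2 * u ^ (e₂ + 1)) * (b 1 + b 2 * v ^ (e₂ + 1))) := by ring
      rw [hfac] at hend
      exact (mul_nonneg_iff_of_pos_left (mul_pos (pow_pos hu _) (pow_pos hv _))).1 hend
    have hne : b 1 + b 2 * x ^ (e₂ + 1) ≠ 0 :=
      binomial_ne_zero_of_endpoints (b 1) (b 2) (Nat.succ_ne_zero _) hu hx hend' hb2
    have hF : (0 : ℝ) - (-(b 1)) * x ^ (e₁ + 1) - (-(b 2)) * x ^ (e₁ + e₂ + 2) ≠ 0 := by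
      have : (0 : ℝ) - (-(b 1)) * x ^ (e₁ + 1) - (-(b 2)) * x ^ (e₁ + e₂ + 2) = x ^ (e₁ + 1) * (b 1 + b 2 * x ^ (e₂ + 1)) := by ring
      rw [this]; exact mul_ne_zero (pow_ne_zero _ hx0.ne') hne
    have hψ : 0 < rowPsi1 e₁ e₂ 0 (-(b 1)) (-(b 2)) x := pair12_pole_rowPsi1_pos e₁ e₂ (-(b 1)) (-(b 2)) hx0 (by nlinarith) hF
    rw [h0]
    refine ⟨hF, ?_, ?_, hψ⟩
    · have h := pair12_rowPsi3_law e₁ e₂ (-(b 1)) (-(b 2)) hF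
      rw [hs]; linarith [h]
    · rw [hs]; exact pair12_rowPsi2_sq e₁ e₂ (-(b 1)) (-(b 2)) hF
  · -- (P02) pole, rate p + s
    refine ⟨p + s, Or.inr (Or.inr rfl), ?_, ?_, fun x hx => ?_⟩
    · rw [sixthOrder_c0_fast p s]; positivity
    · rw [sixthOrder_c1_fast p s]; positivity
    have hx0 := huv_pos x hx
    have hn1 : -(b 1) = 0 := by rw [h1, neg_zero]
    have hb2 : b 2 ≠ 0 := by rintro h; rw [h, mul_zero] at hsgn; exact lt_irrefl _ hsgn
    have hend' : 0 ≤ (b 0 + b 2 * u ^ (e₁ + e₂ + 2)) * (b 0 + b 2 * v ^ (e₁ + e₂ + 2)) := by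
      rw [h1] at hend; simpa using hend
    have hne : b 0 + b 2 * x ^ (e₁ + e₂ + 2) ≠ 0 :=
      binomial_ne_zero_of_endpoints (b 0) (b 2) (Nat.succ_ne_zero _) hu hx hend' hb2
    have hF : b 0 - (-(b 2)) * x ^ (e₁ + e₂ + 2) ≠ 0 := by
      have : b 0 - (-(b 2)) * x ^ (e₁ + e₂ + 2) = b 0 + b 2 * x ^ (e₁ + e₂ + 2) := by ring
      rwa [this]
    have hψ : 0 < rowPsi1 e₁ e₂ (b 0) 0 (-(b 2)) x := pair02_pole_rowPsi1_pos e₁ e₂ (b 0) (-(b 2)) hx0 (by nlinarith) hF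
    rw [hn1]
    refine ⟨by rwa [zero_mul, sub_zero], ?_, ?_, hψ⟩
    · have h := pair02_rowPsi3_law e₁ e₂ (b 0) (-(b 2)) x
      rw [hp, hs]
      have : ((e₁ : ℝ) + 1 + ((e₂ : ℝ) + 1)) = ((e₁ : ℝ) + e₂ + 2) := by ring
      rw [this]; linarith [h]
    · rw [hp, hs]
      have : ((e₁ : ℝ) + 1 + ((e₂ : ℝ) + 1)) = ((e₁ : ℝ) + e₂ + 2) := by ring
      rw [this]; exact pair02_rowPsi2_sq e₁ e₂ (b 0) (-(b 2)) x

/-- **Ringed-knee facts** (items K12 / K02 with the window INSIDE the ring, `2p ≤ s`): the rate, the ring roots `0 < L < U`, `4U ≤ r²`,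
`c₁(r) = 5040(L+U)`, `c₀(r) = 5040LU`, and on the window: normal form `≠ 0`, both closure laws, `ψ₁ < 0`, and the bracket `< 0` in generic form.
[this file's lemma] -/
theorem ringIso_knee_facts (e₁ e₂ : ℕ) (h2p : 2 * (e₁ + 1) ≤ e₂ + 1) (b : Fin 3 → ℝ) {u v : ℝ} (hu : 0 < u)
    (hrow :
      (b 0 = 0 ∧ 0 < b 1 * b 2 ∧ ∀ x ∈ Ioo u v,
          6 * ((((e₂ : ℝ) + 1) - ((e₁ : ℝ) + 1)) * (2 * ((e₂ : ℝ) + 1) - ((e₁ : ℝ) + 1)) * (2 * ((e₂ : ℝ) + 1) + ((e₁ : ℝ) + 1)) * (3 * ((e₂ : ℝ) + 1)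
                  + ((e₁ : ℝ) + 1)))
            + 240 * ((3 * ((e₂ : ℝ) + 1) + ((e₁ : ℝ) + 1)) * (2 * ((e₂ : ℝ) + 1) - ((e₁ : ℝ) + 1))) * rowPsi1 e₁ e₂ (b 0) (-(b 1)) (-(b 2)) x
                    + 5040 * rowPsi1 e₁ e₂ (b 0) (-(b 1)) (-(b 2)) x ^ 2 < 0) ∨
      (b 1 = 0 ∧ 0 < b 0 * b 2 ∧ ∀ x ∈ Ioo u v,
          6 * (12 * ((e₁ : ℝ) + 1) ^ 4 + 56 * ((e₁ : ℝ) + 1) ^ 3 * ((e₂ : ℝ) + 1) + 89 * ((e₁ : ℝ) + 1) ^ 2 * ((e₂ : ℝ) + 1) ^ 2 + 56 * ((e₁ : ℝ) + 1)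
                  * ((e₂ : ℝ) + 1) ^ 3 + 12 * ((e₂ : ℝ) + 1) ^ 4)
            + 120 * (12 * ((e₁ : ℝ) + 1) ^ 2 + 26 * ((e₁ : ℝ) + 1) * ((e₂ : ℝ) + 1) + 12 * ((e₂ : ℝ) + 1) ^ 2) * rowPsi1 e₁ e₂ (b 0) (-(b 1)) (-(b 2)) x
                    + 5040 * rowPsi1 e₁ e₂ (b 0) (-(b 1)) (-(b 2)) x ^ 2 < 0)) :
    ∃ r L U : ℝ, (r = ((e₁ : ℝ) + 1) ∨ r = ((e₂ : ℝ) + 1) ∨ r = ((e₁ : ℝ) + 1) + ((e₂ : ℝ) + 1)) ∧ 0 < L ∧ L < U ∧ 4 * U ≤ r ^ 2 ∧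
      120 * (14 * r ^ 2 - (((e₁ : ℝ) + 1) ^ 2 + ((e₂ : ℝ) + 1) ^ 2 + (((e₁ : ℝ) + 1) + ((e₂ : ℝ) + 1)) ^ 2)) = 5040 * (L + U) ∧
      6 * (21 * r ^ 4 - 5 * (((e₁ : ℝ) + 1) ^ 2 + ((e₂ : ℝ) + 1) ^ 2 + (((e₁ : ℝ) + 1) + ((e₂ : ℝ) + 1)) ^ 2) * r ^ 2 + (((e₁ : ℝ) + 1) ^ 2 * ((e₂ : ℝ)
              + 1) ^ 2 + ((e₁ : ℝ) + 1) ^ 2 * (((e₁ : ℝ) + 1) + ((e₂ : ℝ) + 1)) ^ 2 + ((e₂ : ℝ) + 1) ^ 2 * (((e₁ : ℝ) + 1) + ((e₂ : ℝ)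
              + 1)) ^ 2)) = 5040 * L * U ∧ ∀ x ∈ Ioo u v,
      b 0 - (-(b 1)) * x ^ (e₁ + 1) - (-(b 2)) * x ^ (e₁ + e₂ + 2) ≠ 0 ∧
      rowPsi3 e₁ e₂ (b 0) (-(b 1)) (-(b 2)) x
        = r ^ 2 * rowPsi1 e₁ e₂ (b 0) (-(b 1)) (-(b 2)) x + 6 * rowPsi1 e₁ e₂ (b 0) (-(b 1)) (-(b 2)) x ^ 2 ∧
      rowPsi2 e₁ e₂ (b 0) (-(b 1)) (-(b 2)) x ^ 2
        = r ^ 2 * rowPsi1 e₁ e₂ (b 0) (-(b 1)) (-(b 2)) x ^ 2 + 4 * rowPsi1 e₁ e₂ (b 0) (-(b 1)) (-(b 2)) x ^ 3 ∧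
      rowPsi1 e₁ e₂ (b 0) (-(b 1)) (-(b 2)) x < 0 ∧
      6 * (21 * r ^ 4 - 5 * (((e₁ : ℝ) + 1) ^ 2 + ((e₂ : ℝ) + 1) ^ 2 + (((e₁ : ℝ) + 1) + ((e₂ : ℝ) + 1)) ^ 2) * r ^ 2 + (((e₁ : ℝ) + 1) ^ 2 * ((e₂ : ℝ)
              + 1) ^ 2 + ((e₁ : ℝ) + 1) ^ 2 * (((e₁ : ℝ) + 1) + ((e₂ : ℝ) + 1)) ^ 2 + ((e₂ : ℝ) + 1) ^ 2 * (((e₁ : ℝ) + 1) + ((e₂ : ℝ) + 1)) ^ 2))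
        + 120 * (14 * r ^ 2 - (((e₁ : ℝ) + 1) ^ 2 + ((e₂ : ℝ) + 1) ^ 2 + (((e₁ : ℝ) + 1) + ((e₂ : ℝ)
                + 1)) ^ 2)) * rowPsi1 e₁ e₂ (b 0) (-(b 1)) (-(b 2)) x + 5040 * rowPsi1 e₁ e₂ (b 0) (-(b 1)) (-(b 2)) x ^ 2 < 0 := by
  set p : ℝ := (e₁ : ℝ) + 1 with hp
  set s : ℝ := (e₂ : ℝ) + 1 with hs
  have hp0 : 0 < p := by rw [hp]; positivity
  have hs0 : 0 < s := by rw [hs]; positivity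
  have h2ps : 2 * p ≤ s := by
    rw [hp, hs]
    have : ((2 * (e₁ + 1) : ℕ) : ℝ) ≤ ((e₂ + 1 : ℕ) : ℝ) := by exact_mod_cast h2p
    push_cast at this
    linarith
  have huv_pos : ∀ x ∈ Ioo u v, 0 < x := fun x hx => hu.trans hx.1
  rcases hrow with ⟨h0, hsgn, hring⟩ | ⟨h1, hsgn, hring⟩
  · -- (K12) middle knee, rate s
    obtain ⟨L, U, hL, hLU, h4U, hc1, hc0⟩ := midRing_roots hp0 h2ps
    refine ⟨s, L, U, Or.inr (Or.inl rfl), hL, hLU, h4U, by rw [sixthOrder_c1_mid p s]; exact hc1,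
      by rw [sixthOrder_c0_mid p s]; exact hc0, fun x hx => ?_⟩
    have hx0 := huv_pos x hx
    have hBC : 0 < (-(b 1)) * (-(b 2)) := by nlinarith
    have hψ := pair12_knee_rowPsi1_neg e₁ e₂ (-(b 1)) (-(b 2)) hx0 hBC
    have hsame : b 1 + b 2 * x ^ (e₂ + 1) ≠ 0 := by
      intro h
      have : b 1 * (b 1 + b 2 * x ^ (e₂ + 1)) = 0 := by rw [h, mul_zero]
      nlinarith [mul_self_nonneg (b 1), mul_pos hsgn (pow_pos hx0 (e₂ + 1))]
    have hF : (0 : ℝ) - (-(b 1)) * x ^ (e₁ + 1) - (-(b 2)) * x ^ (e₁ + e₂ + 2) ≠ 0 := by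
      have : (0 : ℝ) - (-(b 1)) * x ^ (e₁ + 1) - (-(b 2)) * x ^ (e₁ + e₂ + 2) = x ^ (e₁ + 1) * (b 1 + b 2 * x ^ (e₂ + 1)) := by ring
      rw [this]; exact mul_ne_zero (pow_ne_zero _ hx0.ne') hsame
    have hq := hring x hx
    rw [h0] at hq ⊢
    refine ⟨hF, ?_, ?_, hψ, ?_⟩
    · have h := pair12_rowPsi3_law e₁ e₂ (-(b 1)) (-(b 2)) hF
      rw [hs]; linarith [h]
    · rw [hs]; exact pair12_rowPsi2_sq e₁ e₂ (-(b 1)) (-(b 2)) hF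
    · rw [sixthOrder_c0_mid p s, sixthOrder_c1_mid p s, hp, hs]; exact hq
  · -- (K02) fast knee, rate p + s
    obtain ⟨L, U, hL, hLU, h4U, hc1, hc0⟩ := fastRing_roots hp0 hs0
    refine ⟨p + s, L, U, Or.inr (Or.inr rfl), hL, hLU, h4U, by rw [sixthOrder_c1_fast p s]; exact hc1,
      by rw [sixthOrder_c0_fast p s]; exact hc0, fun x hx => ?_⟩
    have hx0 := huv_pos x hx
    have hn1 : -(b 1) = 0 := by rw [h1, neg_zero]
    have hAC : b 0 * (-(b 2)) < 0 := by nlinarith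
    have hψ := knee_rowPsi1_neg e₁ e₂ (b 0) (-(b 2)) hx0 hAC
    have hF : b 0 - (-(b 2)) * x ^ (e₁ + e₂ + 2) ≠ 0 := by
      intro h
      have hA : b 0 = -(b 2) * x ^ (e₁ + e₂ + 2) := by linarith
      rw [hA] at hAC
      nlinarith [sq_nonneg (b 2), pow_pos hx0 (e₁ + e₂ + 2)]
    have hq := hring x hx
    rw [hn1] at hq ⊢
    refine ⟨by rwa [zero_mul, sub_zero], ?_, ?_, hψ, ?_⟩
    · have h := pair02_rowPsi3_law e₁ e₂ (b 0) (-(b 2)) x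
      rw [hp, hs]
      have : ((e₁ : ℝ) + 1 + ((e₂ : ℝ) + 1)) = ((e₁ : ℝ) + e₂ + 2) := by ring
      rw [this]; linarith [h]
    · rw [hp, hs]
      have : ((e₁ : ℝ) + 1 + ((e₂ : ℝ) + 1)) = ((e₁ : ℝ) + e₂ + 2) := by ring
      rw [this]; exact pair02_rowPsi2_sq e₁ e₂ (b 0) (-(b 2)) x
    · rw [sixthOrder_c0_fast p s, sixthOrder_c1_fast p s, hp, hs]; exact hq

end ProductPlusOne

end Summit.ValiantsHypothesis.ValiantsHypothesis.Theorems.LacunarySymmetroidMatrixDescartes
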